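import Mathlib.Tactic.Group
import Literature.AnabelianGeometry.SemiGraphs.TemperedOuterActionOfResFamily
import Literature.AnabelianGeometry.SemiGraphs.TemperedFunctorialityWithHom
import Literature.AnabelianGeometry.SemiGraphs.ArithTemperedGroupBranchPair
import HarnessLib

/-!
# [SemiAnbd] Def 5.1 (i) / Prop 5.2 (iv): the outer arithmetic action and the chart-compatibility
# binders DERIVED from an action of `Π_A` on `𝒢` by automorphisms of the semi-graph of anabelioids

Mochizuki, *Semi-graphs of anabelioids*, Publ. RIMS **42** (2006), §5 Def 5.1 (i) p. 62 ("an action of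
`π̂₁(A)` on `𝔾`"), Prop 5.2 (iv) p. 64, p. 65 ll. 4–14; §3 Prop 3.6 (iv) p. 39, Prop 3.2 p. 35.
[cite: MochizukiSemiAnbd2006, Def 5.1 (i), p. 62]

PROOF-ONLY file (no definitions), step 2 of row T54-B-func (plan/GAP-LEDGER.md G-w4d053-1; L3-lead α6
«∃-form, abstract binders, no ofReal»).  An action of `Π_A` on `𝒢` is given in the tree's vocabulary as
a family `F : Π_A → ProfiniteSemiGraph.Hom 𝒢 𝒢` (abc-iut-L3-t2) which is PSEUDO-FUNCTORIAL on tempered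
coverings — `F_{ab}^* ≅ F_a^* ⋙ F_b^*` and `F_1^* ≅ 𝟭` for abc-iut-L3-t10's chart pull-back functors
`F^* = Hom.chartPullback c c : B^temp(π₁^temp 𝒢) ⥤ B^temp(π₁^temp 𝒢)` (binders `hmul`, `hone`) — and
LOCALLY SURJECTIVE (`hV v`, `hE e` onto; automorphisms are locally trivial).  Then:

* `exists_outerAction_of_graphAction`: Prop 3.6 (iv) (`Hom.exists_inducedHom_with`, t10) gives
  `φ_a : π₁^temp(𝒢) → π₁^temp(𝒢)` with `F_a^* ≅ B^temp(φ_a)`; by `exists_outerAction_of_resFamily`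
  (Prop 3.2) these assemble to an OUTER ACTION `ρ : Π_A →* Out(π₁^temp 𝒢)` by bi-continuous
  automorphisms `Φ_a` — the `ρ` that `ArithTemperedGroupOfOuterAction.lean` takes as INPUT;
* `map_mem_verticialSubgroups_of_chartPullback_iso` / `…edgeLike…` / `exists_branchPair_of_chartPullback_iso`:
  the three chart-compatibility binders of that file and of `ArithTemperedGroupBranchPair.lean`
  (`hV`, `hE`, `hBR` = Prop 3.6 (iv) at `ρ_𝔾(a)` on verticial subgroups, edge-like subgroups, and
  host/branch PAIRS) are THEOREMS for such `Φ_a` (vertex/edge compatibility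
  `Hom.conj_of_chartPullbackWith_iso(_edge)` + the branch square `Hom.conjugator_spec`);
* `exists_outerAction_binders_of_graphAction`: packaged — ∃ ρ with all three binders;
* `exists_arithTemperedGroup_of_graphAction`: composed with `exists_arithTemperedGroup_alg` — from the
  graph action alone (+ Def 5.1 (i)(c) on the base action): `∃ Π^temp_𝔊, ι, aug` exact with
  `ArithChartAction`.

Honest scope: the TEMPERED TOPOLOGY on `Π^temp_𝔊` stays with abc-iut-L3-d2/L3-d4 (T54-B-top/tower);
the pseudo-functoriality isos `hmul`/`hone` are binders (the tree has no composition law for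
`Hom.chartPullback`).  No side taken on [IUTchIII] Cor 3.12; typed ≠ proved.
-/

namespace Literature.AnabelianGeometry.SemiGraphs

open CategoryTheory Literature.AnabelianGeometry.EtaleTheta

universe u w

namespace ProfiniteSemiGraph

section Helpers

variable {G : Type*} [Group G]

/-- `h K h⁻¹ = K` for `h ∈ K`. [folklore] -/
private theorem map_conj_eq_self_of_mem (K : Subgroup G) {h : G} (hh : h ∈ K) :
    K.map (MulAut.conj h).toMonoidHom = K := by
  ext x
  simp only [Subgroup.mem_map, MulEquiv.coe_toMonoidHom, MulAut.conj_apply]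
  constructor
  · rintro ⟨k, hk, rfl⟩
    exact K.mul_mem (K.mul_mem hh hk) (K.inv_mem hh)
  · intro hx
    exact ⟨h⁻¹ * x * h, K.mul_mem (K.mul_mem (K.inv_mem hh) hx) hh, by group⟩

/-- `y (x K x⁻¹) y⁻¹ = (y x) K (y x)⁻¹`. [folklore] -/
private theorem map_conj_map_conj'' (K : Subgroup G) (x y : G) :
    (K.map (MulAut.conj x).toMonoidHom).map (MulAut.conj y).toMonoidHom =
      K.map (MulAut.conj (y * x)).toMonoidHom := by
  rw [Subgroup.map_map]
  congr 1
  ext t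
  simp only [MonoidHom.coe_comp, MulEquiv.coe_toMonoidHom, Function.comp_apply, MulAut.conj_apply]
  group

/-- Pointwise conjugacy `α = conj(g) ∘ β ∘ f` with `f` surjective gives `range α = g (range β) g⁻¹`.
[folklore] -/
private theorem range_eq_map_conj_of_surj {K K' : Type*} [Group K] [Group K'] (α : K →* G) (β : K' →* G)
    (f : K → K') (hf : Function.Surjective f) (g : G) (h : ∀ x, α x = g * β (f x) * g⁻¹) :
    α.range = β.range.map (MulAut.conj g).toMonoidHom := by
  ext y
  simp only [MonoidHom.mem_range, Subgroup.mem_map, MulEquiv.coe_toMonoidHom, MulAut.conj_apply,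
    exists_exists_eq_and]
  constructor
  · rintro ⟨x, rfl⟩
    exact ⟨f x, (h x).symm⟩
  · rintro ⟨x', rfl⟩
    obtain ⟨x, rfl⟩ := hf x'
    exact ⟨x, h x⟩

/-- Subgroup version: `α(B) = g · β(f B) · g⁻¹`. [folklore] -/
private theorem map_eq_map_conj_of_surjOn {K K' : Type*} [Group K] [Group K'] (α : K →* G)
    (β : K' →* G) (f : K → K') (g : G) (h : ∀ x, α x = g * β (f x) * g⁻¹) (B : Subgroup K)
    (B' : Subgroup K') (hBB' : f '' (B : Set K) = (B' : Set K')) :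
    B.map α = (B'.map β).map (MulAut.conj g).toMonoidHom := by
  ext y
  simp only [Subgroup.mem_map, MulEquiv.coe_toMonoidHom, MulAut.conj_apply, exists_exists_and_eq_and]
  constructor
  · rintro ⟨x, hx, rfl⟩
    refine ⟨f x, ?_, (h x).symm⟩
    have : f x ∈ f '' (B : Set K) := ⟨x, hx, rfl⟩
    rw [hBB'] at this
    exact this
  · rintro ⟨x', hx', rfl⟩
    have : x' ∈ f '' (B : Set K) := by rw [hBB']; exact hx'
    obtain ⟨x, hx, rfl⟩ := this
    exact ⟨x, hx, h x⟩

end Helpers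

variable {𝒢 : ProfiniteSemiGraph.{u}} (c : TemperedPiChart 𝒢)

/-- Under the Prop 3.6 hypotheses every edge of a GRAPH carries an edge homomorphism (Thm 3.7 (iii)
vocabulary; `exists_isEdgeHom` at a branch of the edge, which abuts to a vertex since `𝔾` is a graph).
[cite: MochizukiSemiAnbd2006, Thm 3.7 (iii), p. 41] -/
theorem exists_isEdgeHom_of_isGraph (h36 : 𝒢.Prop36Hypotheses) (hG : 𝒢.graph.IsGraph)
    (e : 𝒢.graph.Edge) : ∃ ψ : 𝒢.Ge e →ₜ* c.G, IsEdgeHom c e ψ := by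
  obtain ⟨b, -, -, hb, -, -⟩ := 𝒢.graph.two_branches e
  subst hb
  obtain ⟨v, hv⟩ := Option.isSome_iff_exists.mp (hG.abuts_isSome b)
  exact exists_isEdgeHom h36.isQuasiCoherent h36.isGaloisCountable h36.isOfInjectiveType c b v hv

/-! ### The chart-compatibility binders for ONE automorphism `F` with `F^* ≅ B^temp(Φ)` -/

section OneHom

variable (F : Hom 𝒢 𝒢) (Φ : contMulAut c.G) (φ : c.G →ₜ* c.G) (hΦ : ∀ t, (Φ : MulAut c.G) t = φ t)
  (hiso : Nonempty (F.chartPullback c c ≅ BTemp.res φ))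

include hΦ in
/-- `H.map Φ = H.map φ` when `Φ = φ` pointwise. [folklore] -/
private theorem map_Φ_eq (H : Subgroup c.G) :
    H.map (Φ : MulAut c.G).toMonoidHom = H.map φ.toMonoidHom := by
  congr 1; ext t; exact hΦ t

include hΦ hiso in
/-- **Binder `hV` as a theorem**: a bi-continuous `Φ` with `F^* ≅ B^temp(Φ)` carries the verticial
subgroups at `v` to verticial subgroups at `F v` (Prop 3.6 (iv) vertex compatibility
`Hom.conj_of_chartPullbackWith_iso` + `F_v` onto). [cite: MochizukiSemiAnbd2006, Prop 3.6 (iv), p. 39] -/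
theorem map_mem_verticialSubgroups_of_chartPullback_iso (h36 : 𝒢.Prop36Hypotheses)
    (hVs : ∀ v, Function.Surjective (F.hV v)) {v : 𝒢.graph.Vertex} {H : Subgroup c.G}
    (hH : H ∈ verticialSubgroups c v) :
    H.map (Φ : MulAut c.G).toMonoidHom ∈ verticialSubgroups c (F.base.vertexMap v) := by
  obtain ⟨ψ', hψ', rfl⟩ := hH
  obtain ⟨ψ, hψ⟩ := exists_isVerticialHom h36.isQuasiCoherent h36.isGaloisCountable c (F.base.vertexMap v)
  obtain ⟨g, hg⟩ := F.conj_of_chartPullbackWith_iso F.chosenConjugators c c φ hiso v ψ' ψ hψ' hψ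
  rw [map_Φ_eq c Φ φ hΦ, MonoidHom.map_range]
  have : (φ.toMonoidHom.comp ψ'.toMonoidHom).range =
      ψ.toMonoidHom.range.map (MulAut.conj g).toMonoidHom :=
    range_eq_map_conj_of_surj _ _ (F.hV v) (hVs v) g (fun x => hg x)
  rw [this]
  exact conj_mem_verticialSubgroups c ⟨ψ, hψ, rfl⟩ g

include hΦ hiso in
/-- **Binder `hE` as a theorem**: the same for edge-like subgroups (edge compatibility
`Hom.conj_of_chartPullbackWith_iso_edge` + `F_e` onto; edge homomorphisms exist on a graph).
[cite: MochizukiSemiAnbd2006, Prop 3.6 (iv), p. 39] -/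
theorem map_mem_edgeLikeSubgroups_of_chartPullback_iso (h36 : 𝒢.Prop36Hypotheses)
    (hG : 𝒢.graph.IsGraph) (hEs : ∀ e, Function.Surjective (F.hE e)) {e : 𝒢.graph.Edge}
    {K : Subgroup c.G} (hK : K ∈ edgeLikeSubgroups c e) :
    K.map (Φ : MulAut c.G).toMonoidHom ∈ edgeLikeSubgroups c (F.base.edgeMap e) := by
  obtain ⟨ψ', hψ', rfl⟩ := hK
  obtain ⟨ψ, hψ⟩ := exists_isEdgeHom_of_isGraph c h36 hG (F.base.edgeMap e)
  obtain ⟨g, hg⟩ := F.conj_of_chartPullbackWith_iso_edge F.chosenConjugators c c φ hiso e ψ' ψ hψ' hψ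
  rw [map_Φ_eq c Φ φ hΦ, MonoidHom.map_range]
  have : (φ.toMonoidHom.comp ψ'.toMonoidHom).range =
      ψ.toMonoidHom.range.map (MulAut.conj g).toMonoidHom :=
    range_eq_map_conj_of_surj _ _ (F.hE e) (hEs e) g (fun x => hg x)
  rw [this]
  exact conj_mem_edgeLikeSubgroups' c ⟨ψ, hψ, rfl⟩ g

/-- The branch square of a morphism, on subgroups: `F_v(Π_b) = g · Π_{F b} · g⁻¹` inside `Π_{F v}` for
the chosen conjugating element `g` of `Hom.conjugator_spec`, when `F_{e}` is onto.
[cite: MochizukiSemiAnbd2006, Rmk 2.4.2, p. 26] -/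
theorem map_branchSubgroup_eq_conj (hEs : ∀ e, Function.Surjective (F.hE e)) (b : 𝒢.graph.Branch)
    (v : 𝒢.graph.Vertex) (hb : 𝒢.graph.abuts b = some v) :
    (𝒢.branchSubgroup b v hb).map (F.hV v).toMonoidHom =
      (𝒢.branchSubgroup (F.base.branchMap b) (F.base.vertexMap v) (F.base.abuts_branchMap b v hb)).map
        (MulAut.conj (F.conjugator b v hb)).toMonoidHom := by
  -- `branchSubgroup = range b_*`; `F_v ∘ b_* = conj(g) ∘ (F b)_* ∘ F_e` pointwise
  have h := fun x => (F.conjugator_spec b v hb x).symm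
  unfold branchSubgroup
  rw [MonoidHom.map_range]
  have key : ((F.hV v).toMonoidHom.comp (𝒢.brHom b v hb).toMonoidHom).range =
      (𝒢.brHomAt (F.base.branchMap b) (F.base.vertexMap v) (F.base.abuts_branchMap b v hb)
          (F.base.edgeMap (𝒢.graph.edgeOf b)) (F.base.edgeOf_branchMap b)).toMonoidHom.range.map
        (MulAut.conj (F.conjugator b v hb)).toMonoidHom :=
    range_eq_map_conj_of_surj _ _ (F.hE (𝒢.graph.edgeOf b)) (hEs _) _ (fun x => h x)
  rw [key]
  congr 1
  -- `range (brHomAt … q) = range b'_*`: generalise the edge index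
  generalize F.base.edgeOf_branchMap b = q
  revert q
  generalize F.base.edgeMap (𝒢.graph.edgeOf b) = f
  intro q
  subst q
  rfl

include hΦ hiso in
/-- **Binder `hBR` as a theorem** (abc-iut-w4-d040's branch-granular clause, pair level): for a
verticial homomorphism `φᵥ` at `v` and a branch `b` abutting to `v` there are a verticial `φ'` at `F v`
and `x'` with `Φ(φᵥ(Π_v)) = x' φ'(Π_{F v}) x'⁻¹` AND `Φ(φᵥ(Π_b)) = x' φ'(Π_{F b}) x'⁻¹`
(`x' = y · φ'(g)`: `y` from Prop 3.6 (iv) vertex compatibility, `g` the branch conjugator).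
[cite: MochizukiSemiAnbd2006, Prop 3.6 (iv), p. 39] -/
theorem exists_branchPair_of_chartPullback_iso (h36 : 𝒢.Prop36Hypotheses)
    (hVs : ∀ v, Function.Surjective (F.hV v)) (hEs : ∀ e, Function.Surjective (F.hE e))
    (b : 𝒢.graph.Branch) (v : 𝒢.graph.Vertex) (hb : 𝒢.graph.abuts b = some v)
    (φᵥ : 𝒢.Gv v →ₜ* c.G) (hφᵥ : IsVerticialHom c v φᵥ) :
    ∃ φ' : 𝒢.Gv (F.base.vertexMap v) →ₜ* c.G, IsVerticialHom c (F.base.vertexMap v) φ' ∧ ∃ x' : c.G,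
      Subgroup.map (Φ : MulAut c.G).toMonoidHom φᵥ.toMonoidHom.range =
        Subgroup.map (MulAut.conj x').toMonoidHom φ'.toMonoidHom.range ∧
      Subgroup.map (Φ : MulAut c.G).toMonoidHom (Subgroup.map φᵥ.toMonoidHom (𝒢.branchSubgroup b v hb)) =
        Subgroup.map (MulAut.conj x').toMonoidHom (Subgroup.map φ'.toMonoidHom
          (𝒢.branchSubgroup (F.base.branchMap b) (F.base.vertexMap v) (F.base.abuts_branchMap b v hb))) := by
  obtain ⟨φ', hφ'⟩ := exists_isVerticialHom h36.isQuasiCoherent h36.isGaloisCountable c (F.base.vertexMap v)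
  obtain ⟨y, hy⟩ := F.conj_of_chartPullbackWith_iso F.chosenConjugators c c φ hiso v φᵥ φ' hφᵥ hφ'
  set g := F.conjugator b v hb with hg
  refine ⟨φ', hφ', y * φ' g, ?_, ?_⟩
  · -- host part
    rw [map_Φ_eq c Φ φ hΦ, MonoidHom.map_range]
    have : (φ.toMonoidHom.comp φᵥ.toMonoidHom).range =
        φ'.toMonoidHom.range.map (MulAut.conj y).toMonoidHom :=
      range_eq_map_conj_of_surj _ _ (F.hV v) (hVs v) y (fun x => hy x)
    rw [this, ← map_conj_map_conj'' _ (φ' g) y]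
    congr 1
    exact (map_conj_eq_self_of_mem _ (MonoidHom.mem_range.mpr ⟨g, rfl⟩)).symm
  · -- branch part: `Φ(φᵥ(Π_b)) = y · φ'(F_v(Π_b)) · y⁻¹ = y · φ'(g Π_{Fb} g⁻¹) · y⁻¹`
    rw [map_Φ_eq c Φ φ hΦ, Subgroup.map_map]
    have h1 : Subgroup.map (φ.toMonoidHom.comp φᵥ.toMonoidHom) (𝒢.branchSubgroup b v hb) =
        ((Subgroup.map (F.hV v).toMonoidHom (𝒢.branchSubgroup b v hb)).map φ'.toMonoidHom).map
          (MulAut.conj y).toMonoidHom := by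
      exact map_eq_map_conj_of_surjOn _ _ (F.hV v) y (fun x => hy x) _ _ (Subgroup.coe_map _ _).symm
    rw [h1, map_branchSubgroup_eq_conj F hEs b v hb, ← hg, Subgroup.map_map _ _ ((MulAut.conj g).toMonoidHom)]
    -- `φ' ∘ conj g = conj (φ' g) ∘ φ'`
    have h2 : φ'.toMonoidHom.comp (MulAut.conj g).toMonoidHom =
        (MulAut.conj (φ' g)).toMonoidHom.comp φ'.toMonoidHom := by
      ext t; simp [MulAut.conj_apply, map_mul, map_inv]
    rw [h2, ← Subgroup.map_map, map_conj_map_conj'']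

end OneHom

/-! ### The outer action and its binders, from a pseudo-functorial locally-surjective action -/

variable {PA : Type w} [Group PA] (F : PA → Hom 𝒢 𝒢)

/-- **The outer arithmetic action** (Def 5.1 (i) ⇒ Prop 5.2 (iv)'s outer representation): a
pseudo-functorial action of `Π_A` on `𝒢` by morphisms of semi-graphs of anabelioids induces a
homomorphism `ρ : Π_A → Out(π₁^temp 𝒢)` whose classes are represented by bi-continuous automorphisms
`Φ_a` with `F_a^* ≅ B^temp(Φ_a)` (Prop 3.6 (iv) `Hom.exists_inducedHom_with` + Prop 3.2
`exists_outerAction_of_resFamily`). [cite: MochizukiSemiAnbd2006, Prop 5.2 (iv), p. 64] -/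
theorem exists_outerAction_of_graphAction
    (hmul : ∀ a b, Nonempty ((F (a * b)).chartPullback c c ≅
      (F a).chartPullback c c ⋙ (F b).chartPullback c c))
    (hone : Nonempty ((F 1).chartPullback c c ≅ 𝟭 (BTemp c.G))) :
    ∃ ρ : PA →* TopOut c.G, ∀ a, ∃ (Φ : contMulAut c.G) (φ : c.G →ₜ* c.G),
      TopOut.mk c.G Φ = ρ a ∧ (∀ t, (Φ : MulAut c.G) t = φ t) ∧
        Nonempty ((F a).chartPullback c c ≅ BTemp.res φ) := by
  choose φ hφ _ using fun a => (F a).exists_inducedHom_with (F a).chosenConjugators c c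
  -- `(F a).chartPullbackWith chosenConjugators = (F a).chartPullback` definitionally
  have hφ' : ∀ a, Nonempty ((F a).chartPullback c c ≅ BTemp.res (φ a)) := hφ
  have hmul' : ∀ a b, Nonempty (BTemp.res (φ (a * b)) ≅ BTemp.res (φ a) ⋙ BTemp.res (φ b)) :=
    fun a b => ⟨(hφ' (a * b)).some.symm ≪≫ (hmul a b).some ≪≫
      NatIso.hcomp (hφ' a).some (hφ' b).some⟩
  have hone' : Nonempty (BTemp.res (φ 1) ≅ 𝟭 (BTemp c.G)) := ⟨(hφ' 1).some.symm ≪≫ hone.some⟩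
  obtain ⟨ρ, hρ⟩ := exists_outerAction_of_resFamily c.isTempered φ hmul' hone'
  refine ⟨ρ, fun a => ?_⟩
  obtain ⟨Φ, hΦρ, hΦφ⟩ := hρ a
  exact ⟨Φ, φ a, hΦρ, hΦφ, hφ' a⟩

/-- **The three chart-compatibility binders, packaged**: from a pseudo-functorial, locally
surjective action of `Π_A` on a graph of anabelioids `𝒢` (Prop 3.6 hypotheses) there is an outer
action `ρ : Π_A →* Out(π₁^temp 𝒢)` satisfying `hV`, `hE` (`ArithTemperedGroupOfOuterAction.lean`) and
`hBR` (`ArithTemperedGroupBranchPair.lean`) with respect to the base action `a ↦ (F a).base`.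
[cite: MochizukiSemiAnbd2006, Def 5.1 (i), p. 62] -/
theorem exists_outerAction_binders_of_graphAction (h36 : 𝒢.Prop36Hypotheses)
    (hG : 𝒢.graph.IsGraph)
    (hmul : ∀ a b, Nonempty ((F (a * b)).chartPullback c c ≅
      (F a).chartPullback c c ⋙ (F b).chartPullback c c))
    (hone : Nonempty ((F 1).chartPullback c c ≅ 𝟭 (BTemp c.G)))
    (hVs : ∀ a v, Function.Surjective ((F a).hV v)) (hEs : ∀ a e, Function.Surjective ((F a).hE e)) :
    ∃ ρ : PA →* TopOut c.G,
      (∀ (a : PA) (v : 𝒢.graph.Vertex) (H : Subgroup c.G), H ∈ verticialSubgroups c v →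
        ∃ Φ : contMulAut c.G, TopOut.mk c.G Φ = ρ a ∧
          H.map (Φ : MulAut c.G).toMonoidHom ∈ verticialSubgroups c ((F a).base.vertexMap v)) ∧
      (∀ (a : PA) (e : 𝒢.graph.Edge) (K : Subgroup c.G), K ∈ edgeLikeSubgroups c e →
        ∃ Φ : contMulAut c.G, TopOut.mk c.G Φ = ρ a ∧
          K.map (Φ : MulAut c.G).toMonoidHom ∈ edgeLikeSubgroups c ((F a).base.edgeMap e)) ∧
      (∀ (a : PA) (b : 𝒢.graph.Branch) (v : 𝒢.graph.Vertex) (hb : 𝒢.graph.abuts b = some v)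
        (φᵥ : 𝒢.Gv v →ₜ* c.G), IsVerticialHom c v φᵥ →
        ∃ Φ : contMulAut c.G, TopOut.mk c.G Φ = ρ a ∧
          ∃ φ' : 𝒢.Gv ((F a).base.vertexMap v) →ₜ* c.G,
            IsVerticialHom c ((F a).base.vertexMap v) φ' ∧ ∃ x' : c.G,
              Subgroup.map (Φ : MulAut c.G).toMonoidHom φᵥ.toMonoidHom.range =
                Subgroup.map (MulAut.conj x').toMonoidHom φ'.toMonoidHom.range ∧
              Subgroup.map (Φ : MulAut c.G).toMonoidHom
                  (Subgroup.map φᵥ.toMonoidHom (𝒢.branchSubgroup b v hb)) =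
                Subgroup.map (MulAut.conj x').toMonoidHom (Subgroup.map φ'.toMonoidHom
                  (𝒢.branchSubgroup ((F a).base.branchMap b) ((F a).base.vertexMap v)
                    ((F a).base.abuts_branchMap b v hb)))) := by
  obtain ⟨ρ, hρ⟩ := exists_outerAction_of_graphAction c F hmul hone
  refine ⟨ρ, fun a v H hH => ?_, fun a e K hK => ?_, fun a b v hb φᵥ hφᵥ => ?_⟩
  · obtain ⟨Φ, φ, hΦρ, hΦφ, hiso⟩ := hρ a
    exact ⟨Φ, hΦρ, map_mem_verticialSubgroups_of_chartPullback_iso c (F a) Φ φ hΦφ hiso h36 (hVs a) hH⟩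
  · obtain ⟨Φ, φ, hΦρ, hΦφ, hiso⟩ := hρ a
    exact ⟨Φ, hΦρ,
      map_mem_edgeLikeSubgroups_of_chartPullback_iso c (F a) Φ φ hΦφ hiso h36 hG (hEs a) hK⟩
  · obtain ⟨Φ, φ, hΦρ, hΦφ, hiso⟩ := hρ a
    exact ⟨Φ, hΦρ,
      exists_branchPair_of_chartPullback_iso c (F a) Φ φ hΦφ hiso h36 (hVs a) (hEs a) b v hb φᵥ hφᵥ⟩


/-! ### T54-B minus topology, from the graph action alone -/

section WithBase

variable [TopologicalSpace PA] (baseAct : PA →* Aut 𝒢.graph)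

/-- **The outer semi-direct product model carries the chart action, from the GRAPH ACTION alone**:
for `𝒢` a graph of anabelioids under the Prop 3.6 hypotheses, a pseudo-functorial, locally surjective
action `F` of `Π_A` on `𝒢` lying over `baseAct : Π_A → Aut 𝔾` with Def 5.1 (i)(c) (`hopen`), the
derived outer action `ρ` makes `Π^temp_𝔊 := π₁^temp(𝒢) ⋊^out_ρ Π_A` (exact by
`ProfiniteSemiGraph.outerAction_exact`) satisfy abc-iut-w4-d053's `ArithChartAction` — composite of
`exists_outerAction_binders_of_graphAction` with `arithChartAction_outerAction`
(`ArithTemperedGroupOfOuterAction.lean`); no binder on `π₁^temp(𝒢)`-level data remains.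
[cite: MochizukiSemiAnbd2006, Prop 5.2 (iv), p. 64] -/
theorem exists_outerAction_arithChartAction_of_graphAction (h36 : 𝒢.Prop36Hypotheses)
    (hG : 𝒢.graph.IsGraph) (hbase : ∀ a, (F a).base = (baseAct a).hom)
    (hmul : ∀ a b, Nonempty ((F (a * b)).chartPullback c c ≅
      (F a).chartPullback c c ⋙ (F b).chartPullback c c))
    (hone : Nonempty ((F 1).chartPullback c c ≅ 𝟭 (BTemp c.G)))
    (hVs : ∀ a v, Function.Surjective ((F a).hV v)) (hEs : ∀ a e, Function.Surjective ((F a).hE e))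
    (hopen : ∃ U : Subgroup PA, IsOpen (U : Set PA) ∧ ∀ a ∈ U,
      (∀ v, (baseAct a).hom.vertexMap v = v) ∧ (∀ e, (baseAct a).hom.edgeMap e = e) ∧
        ∀ b, (baseAct a).hom.branchMap b = b) :
    ∃ ρ : PA →* TopOut c.G,
      ArithChartAction c (toOuterSemidirectProduct ρ) (outerSemidirectProductSnd ρ)
        (fun a v => (baseAct a).hom.vertexMap v) (fun a e => (baseAct a).hom.edgeMap e)
        (fun a b => (baseAct a).hom.branchMap b) := by
  obtain ⟨ρ, hV, hE, -⟩ := exists_outerAction_binders_of_graphAction c F h36 hG hmul hone hVs hEs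
  refine ⟨ρ, arithChartAction_outerAction c ρ baseAct ?_ ?_ hopen⟩
  · intro a v H hH
    rw [← hbase a]
    exact hV a v H hH
  · intro a e K hK
    rw [← hbase a]
    exact hE a e K hK

end WithBase

section SameUniverse

variable {PA : Type u} [Group PA] [TopologicalSpace PA] (F : PA → Hom 𝒢 𝒢)
  (baseAct : PA →* Aut 𝒢.graph)

/-- **T54-B (GAP-LEDGER G-w4d053-1) minus the tempered topology, from the GRAPH ACTION alone**, in the
row's existential shape (carrier in the universe of `𝒢`, `Π_A : Type u`): `∃ Π^temp_𝔊, ι, aug` with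
`1 → π₁^temp(𝒢) → Π^temp_𝔊 → Π_A → 1` exact, `ι(π₁^temp 𝒢)` normal and `ArithChartAction` — via
`exists_arithTemperedGroup_alg`; the residual inputs are the action's pseudo-functoriality isos and
local surjectivity, nothing on `π₁^temp(𝒢)`. [cite: MochizukiSemiAnbd2006, Prop 5.2 (iv), p. 64] -/
theorem exists_arithTemperedGroup_of_graphAction (h36 : 𝒢.Prop36Hypotheses) (hG : 𝒢.graph.IsGraph)
    (hbase : ∀ a, (F a).base = (baseAct a).hom)
    (hmul : ∀ a b, Nonempty ((F (a * b)).chartPullback c c ≅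
      (F a).chartPullback c c ⋙ (F b).chartPullback c c))
    (hone : Nonempty ((F 1).chartPullback c c ≅ 𝟭 (BTemp c.G)))
    (hVs : ∀ a v, Function.Surjective ((F a).hV v)) (hEs : ∀ a e, Function.Surjective ((F a).hE e))
    (hopen : ∃ U : Subgroup PA, IsOpen (U : Set PA) ∧ ∀ a ∈ U,
      (∀ v, (baseAct a).hom.vertexMap v = v) ∧ (∀ e, (baseAct a).hom.edgeMap e = e) ∧
        ∀ b, (baseAct a).hom.branchMap b = b) :
    ∃ (Gtp : Type u) (_ : Group Gtp) (ι : c.G →* Gtp) (aug : Gtp →* PA),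
      Function.Injective ι ∧ ι.range = aug.ker ∧ Function.Surjective aug ∧ ι.range.Normal ∧
        ArithChartAction c ι aug (fun a v => (baseAct a).hom.vertexMap v)
          (fun a e => (baseAct a).hom.edgeMap e) (fun a b => (baseAct a).hom.branchMap b) := by
  obtain ⟨ρ, hV, hE, -⟩ := exists_outerAction_binders_of_graphAction c F h36 hG hmul hone hVs hEs
  refine exists_arithTemperedGroup_alg c ρ baseAct h36 ?_ ?_ hopen
  · intro a v H hH
    rw [← hbase a]
    exact hV a v H hH
  · intro a e K hK
    rw [← hbase a]
    exact hE a e K hK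

end SameUniverse

end ProfiniteSemiGraph

end Literature.AnabelianGeometry.SemiGraphs
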